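/-
Copyright (c) 2026 the pub-hodgecm-mathlib formalisation cell (harness21).  Prover seat hodgecm-mathlib-LH4-p08 (g5), Track A «(D-RAM) FOUR-FRAME», unit U2H, the census leaf
(ρ2b′-X) `stub_U2H_fixedPointCensus_typeTwo_unit0` — dealer LH4-plan (g12) WORD #16∕#21∕#27 hand T5a «TORIC LEVEL CENSUS» (payer LH4-p14; plan owner LH4-p12 (g4)):
the (R1-TOP-SIDE) TOP BIT IN CLOSED FORM, both sides (sheet v5 `topBit_hyper_iff` ∕ `topBit_aniso_iff`).  2026-09-04.
-/
import Summits.HodgeConjecture.HodgeConjecture.Theorems.F0P3cDyRamToricLevelCensusUnrTopSidePrep   -- ★ (this seat): trace-one integers, the `d − 1` gain, UPPER BOUND, EXISTENCE, coset reps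
import HarnessLib

/-!
# T5a: the (R1-TOP-SIDE) bit law — the top bit `χ` of the depth-refined census in CLOSED FORM

On the top diagonal cells (`j + m = jλ + a`, `e = 2a − m ≥ 1`, `j ≤ jλ`, `a ≥ 1`) of the ★ (R1-TOP) heads (`ncard_levelSetDep_top_hyper` p857538 ∕ `_top_aniso` p857647)
the bit is `χ = [∃ Θ-fixed unit N : |η·(ρN∕N) + κ| ≤ exp(−s₀)]`, `η = ρh∕h`, `κ = ρμ∕μ`, `μ = λ − u` (`λ` Θ-unitary, `u ∈ E¹`), `s₀ = j + a − m`.  With `ℓ := jλ − m`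
(`= v(κ − 1)`) and `v(κ − Θκ) = jλ` (`Θκ = κ·λ∕ρλ`), THIS FILE proves the sheet-v5 (R1-TOP-SIDE) sentences, i.e. exactly the letters ★ T5s `toricCensusSum_unr_v5` consumes
(`hvTopP` ∕ `hvTopM`):
* HYPERBOLIC: `χ ⟺ (∃ k, d + m + 2k = jλ) ∧ 2j + d ≤ 2jλ + 1` — the coset `−η·T♮⁰ = T♮⁰` has depth spectrum `d + 2ℕ` (unit quotients ★ `v_sub_map_le_of_v_le_one` + skew parity ★),
  and `κ` is within `exp(−s)` of `T♮` iff `s ≤ jλ − d + 1` (★ prep UPPER BOUND ∕ EXISTENCE; `s₀ = 2j − jλ`);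
* ANISOTROPIC: `χ ⟺ jλ + 1 = d + m ∧ 2j + d ≤ 2jλ + 1` — the coset `−η·T♮⁰` sits at the single depth `d − 1` (★ `v_one_add_twist_eq_of_parity`).
Binders = the ★ (R1-TOP) heads' frame (without the residue-field-size clauses, unused here) + the sheet's `|2| = |ϖE|^t` + `[IsAdicComplete 𝓂[K'] 𝒪[K']]` (Hensel on the
third field, for the existence half).
HONEST LABEL: HC_CM is proved only modulo the 7 printed citations (2 remaining named inputs: hLiu418 = stmt-HodgeConjecture-24832,
h413 = stmt-HodgeConjecture-24833) until rung 0 closes; (ρ2b′-X) :418 is an OPEN prover target — this file is a helper (`--supports`), proofs only.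
-/

set_option autoImplicit false

open WithZero IsLocalRing
open scoped Valued

namespace Summit.HodgeConjecture.HodgeConjecture.Cruxes.H413.F0P3cDyRamToricLevelCensusUnr

open Literature.NumberTheory.LocalFields.QuadraticOrder Literature.NumberTheory.LocalFields.WildQuadraticDatum

variable {K : Type*} [Field K] [Valued K ℤᵐ⁰] {ρ Θ : K →+* K} {α ϖE h : K} {d t : ℕ}
variable {K' : Type*} [Field K'] [Valued K' ℤᵐ⁰] {σ' : K' →+* K'} {π' : K'}

/-! ## §1 The token element `κ = ρμ∕μ`: `|κ| = 1`, `κρκ = 1`, `|κ − 1| = exp(−(jλ − m))`, `|κ − Θκ| = exp(−jλ)` -/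

/-- **THE TOKEN ELEMENT.**  For `μ = λ − u` with `λΘλ = 1`, `ρu = u`, `uΘu = 1`, `|μ| = exp(−m)`, `|μ − ρμ| = exp(−jλ)`: `κ := ρμ∕μ` is a unit with `κρκ = 1`,
`|κ − 1| = exp(−(jλ − m))`, and — since `Θμ = −μ∕(λu)` gives `Θκ = κ·λ∕ρλ` and `ρλ − λ = ρμ − μ` — `|κ − Θκ| = exp(−jλ)`; also `m ≤ jλ`. [cite: Jacobowitz1962, §4] [cite: Serre1979, Ch. V §3] -/
theorem token_kappa (hρρ : ∀ x, ρ (ρ x) = x) (hvρ : ∀ x, Valued.v (ρ x) = Valued.v x) (hΘρ : ∀ x, Θ (ρ x) = ρ (Θ x))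
    (hvΘ : ∀ x, Valued.v (Θ x) = Valued.v x) {lam u : K} (hlam : lam * Θ lam = 1) (hu : ρ u = u) (hu1 : u * Θ u = 1)
    {m jl : ℕ} (hm : Valued.v (lam - u) = exp (-(m : ℤ))) (hjl : Valued.v ((lam - u) - ρ (lam - u)) = exp (-(jl : ℤ))) :
    Valued.v (ρ (lam - u) / (lam - u)) = 1 ∧ ρ (lam - u) / (lam - u) * ρ (ρ (lam - u) / (lam - u)) = 1 ∧
      Valued.v (ρ (lam - u) / (lam - u) - 1) = exp (-((jl : ℤ) - m)) ∧
      Valued.v (ρ (lam - u) / (lam - u) - Θ (ρ (lam - u) / (lam - u))) = exp (-(jl : ℤ)) ∧ m ≤ jl := by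
  have hμ0 : lam - u ≠ 0 := fun h0 => by rw [h0, map_zero] at hm; exact (exp_ne_zero hm.symm).elim
  have hρμ0 : ρ (lam - u) ≠ 0 := (map_ne_zero ρ).2 hμ0
  have hvμ0 : Valued.v (lam - u) ≠ 0 := (Valuation.ne_zero_iff _).2 hμ0
  have hlam0 : lam ≠ 0 := fun h0 => by rw [h0, zero_mul] at hlam; exact zero_ne_one hlam
  have hu0 : u ≠ 0 := fun h0 => by rw [h0, zero_mul] at hu1; exact zero_ne_one hu1
  have hρlam0 : ρ lam ≠ 0 := (map_ne_zero ρ).2 hlam0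
  have hvlam : Valued.v lam = 1 := v_eq_one_of_v_mul_map_eq_one hvΘ (by rw [hlam]; exact Valuation.map_one _)
  have hΘlam : Θ lam = lam⁻¹ := (inv_eq_of_mul_eq_one_right hlam).symm
  have hΘu : Θ u = u⁻¹ := (inv_eq_of_mul_eq_one_right hu1).symm
  have hκ1 : Valued.v (ρ (lam - u) / (lam - u)) = 1 := by rw [map_div₀, hvρ, div_self hvμ0]
  have hρsub : ρ (lam - u) - (lam - u) = ρ lam - lam := by rw [map_sub, hu]; ring
  have hvρsub : Valued.v (ρ lam - lam) = exp (-(jl : ℤ)) := by rw [← hρsub, ← neg_sub, Valuation.map_neg, hjl]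
  refine ⟨hκ1, ?_, ?_, ?_, ?_⟩
  · rw [map_div₀, hρρ]; field_simp
  · rw [div_sub_one hμ0, map_div₀, hm, ← neg_sub, Valuation.map_neg, hjl, ← exp_sub]; congr 1; ring
  · -- `Θκ = κ·λ∕ρλ`
    have hΘκ : Θ (ρ (lam - u) / (lam - u)) = ρ (lam - u) / (lam - u) * (lam / ρ lam) := by
      have hul : u - lam ≠ 0 := fun h0 => hμ0 (by linear_combination (-1 : K) * h0)
      have hρul : u - ρ lam ≠ 0 := by
        intro h0
        have : ρ (lam - u) = 0 := by rw [map_sub, hu]; linear_combination (-1 : K) * h0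
        exact hρμ0 this
      rw [map_div₀, hΘρ, map_sub Θ, hΘlam, hΘu, map_sub ρ, map_inv₀, map_inv₀, hu, map_sub ρ, hu]
      rw [inv_sub_inv hρlam0 hu0, inv_sub_inv hlam0 hu0]
      field_simp
      ring
    have hid : ρ (lam - u) / (lam - u) - Θ (ρ (lam - u) / (lam - u)) = ρ (lam - u) / (lam - u) * ((ρ lam - lam) / ρ lam) := by
      rw [hΘκ]; field_simp
    rw [hid, map_mul, hκ1, one_mul, map_div₀, hvρ, hvlam, div_one, hvρsub]
  · have hle : Valued.v ((lam - u) - ρ (lam - u)) ≤ Valued.v (lam - u) :=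
      (Valuation.map_sub _ _ _).trans (max_le le_rfl (by rw [hvρ]))
    rw [hjl, hm, exp_le_exp] at hle
    omega

/-! ## §2 The core bound: a Θ-fixed ρ-norm-one `x` within `exp(−s)` of `κ` forces `min(s + d − 1, 2s) ≤ jλ` -/

/-- **CORE BOUND** (★ prep UPPER BOUND applied to `y = κ∕x`): if `x` is `Θ`-fixed with `xρx = 1` and `|κ − x| ≤ exp(−s)` (`s ≥ 1`), while `|κ − Θκ| = exp(−jλ)`, then
`min(s + d − 1, 2s) ≤ jλ`. [cite: Serre1979, Ch. V §3 Prop. 5, Cor. 3] -/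
theorem min_le_of_thetaFixed_near (hρρ : ∀ x, ρ (ρ x) = x) (hvρ : ∀ x, Valued.v (ρ x) = Valued.v x) (hΘΘ : ∀ x, Θ (Θ x) = x)
    (hΘρ : ∀ x, Θ (ρ x) = ρ (Θ x)) (hvΘ : ∀ x, Valued.v (Θ x) = Valued.v x) (hα1 : Valued.v α ≤ 1) (hα : Valued.v (α - ρ α) = 1)
    (hρϖE : ρ ϖE = ϖE) (hϖE : Valued.v ϖE = exp (-1 : ℤ))
    (hσ' : ∀ x, σ' (σ' x) = x) (hfix' : ∀ x : K', σ' x = x → x ≠ 0 → ∃ n : ℤ, Valued.v x = exp (2 * n))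
    (hπ' : Valued.v π' = exp (-1 : ℤ)) (hdd' : Valued.v (π' - σ' π') = Valued.v π' ^ d)
    (jK : K' →+* K) (hjv : ∀ x, Valued.v (jK x) = Valued.v x) (hjfix : ∀ z : K, Θ z = z → ∃ x, jK x = z) (hjσ : ∀ x, jK (σ' x) = ρ (jK x))
    {κ x : K} (hκ : κ * ρ κ = 1) (hΘx : Θ x = x) (hx : x * ρ x = 1) {s : ℕ} (hs : 1 ≤ s) (hκx : Valued.v (κ - x) ≤ exp (-(s : ℤ)))
    {jl : ℕ} (hκΘ : Valued.v (κ - Θ κ) = exp (-(jl : ℤ))) : min ((s : ℤ) + d - 1) (2 * (s : ℤ)) ≤ jl := by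
  have hvx : Valued.v x = 1 := v_eq_one_of_v_mul_map_eq_one hvρ (by rw [hx]; exact Valuation.map_one _)
  have hx0 : x ≠ 0 := fun h0 => by rw [h0, map_zero] at hvx; exact zero_ne_one hvx
  have hρx0 : ρ x ≠ 0 := (map_ne_zero ρ).2 hx0
  -- `y := κ ∕ x`
  have hy : κ / x * ρ (κ / x) = 1 := by rw [map_div₀, div_mul_div_comm, hκ, hx, div_one]
  have hy1 : Valued.v (κ / x - 1) ≤ exp (-(s : ℤ)) := by rw [div_sub_one hx0, map_div₀, hvx, div_one]; exact hκx
  have hyΘ : Valued.v (κ / x - Θ (κ / x)) = exp (-(jl : ℤ)) := by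
    rw [map_div₀, hΘx, ← sub_div, map_div₀, hvx, div_one, hκΘ]
  have hbd := v_sub_map_le_of_mul_map_eq_one hρρ hvρ hΘΘ hΘρ hvΘ hα1 hα hρϖE hϖE hσ' hfix' hπ' hdd' jK hjv hjfix hjσ hy hs hy1
  rw [hyΘ] at hbd
  rcases le_max_iff.1 hbd with h1 | h1 <;> rw [exp_le_exp] at h1 <;> omega

/-! ## §3 (R1-TOP-SIDE, HYPERBOLIC) -/

/-- **(R1-TOP-SIDE, HYPERBOLIC) — THE BIT LAW, sheet v5.**  For `μ = λ − u` (`λ` Θ-unitary, `u ∈ E¹`) on the top diagonal (`j + m = jλ + a`, `e ≥ 1`) and a HYPERBOLIC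
scalar `h`: the (R1-TOP) bit `[∃ Θ-fixed unit N : |(ρh∕h)(ρN∕N) + ρμ∕μ| ≤ exp(−(j + a − m))]` equals `[(∃ k, d + m + 2k = jλ) ∧ 2j + d ≤ 2jλ + 1]` — `κ = ρμ∕μ` dies in
`T_M ∕ T♮` exactly at depth `jλ − d + 1`, read on the unit coset of `T♮` (depth spectrum `d + 2ℕ`).
[cite: Serre1979, Ch. V §3 Prop. 5, Cor. 3] [cite: Jacobowitz1962, §4] [cite: Flicker1998UnitaryFL, p. 84] -/
theorem topBit_hyper_iff [IsAdicComplete 𝓂[K'] 𝒪[K']]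
    (hρρ : ∀ x, ρ (ρ x) = x) (hvρ : ∀ x, Valued.v (ρ x) = Valued.v x) (hΘΘ : ∀ x, Θ (Θ x) = x) (hΘρ : ∀ x, Θ (ρ x) = ρ (Θ x))
    (hvΘ : ∀ x, Valued.v (Θ x) = Valued.v x) (hα1 : Valued.v α ≤ 1) (hα : Valued.v (α - ρ α) = 1)
    (hρϖE : ρ ϖE = ϖE) (hϖE : Valued.v ϖE = exp (-1 : ℤ)) (h2 : Valued.v (2 : K) = Valued.v ϖE ^ t) (_hΘh : Θ h = h) (hh : h ≠ 0)
    (hσ' : ∀ x, σ' (σ' x) = x) (hvσ' : ∀ x, Valued.v (σ' x) = Valued.v x) (hfix' : ∀ x : K', σ' x = x → x ≠ 0 → ∃ n : ℤ, Valued.v x = exp (2 * n))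
    (hπ' : Valued.v π' = exp (-1 : ℤ)) (hdd' : Valued.v (π' - σ' π') = Valued.v π' ^ d) (hd : 1 ≤ d)
    (jK : K' →+* K) (hjv : ∀ x, Valued.v (jK x) = Valued.v x) (hjΘ : ∀ x, Θ (jK x) = jK x)
    (hjfix : ∀ z : K, Θ z = z → ∃ x, jK x = z) (hjσ : ∀ x, jK (σ' x) = ρ (jK x))
    (hnorm : ∀ z : Kˣ, Θ (z : K) = z → Valued.v (z : K) = 1 → ∃ ω : Kˣ, Valued.v (ω : K) = 1 ∧ (ω : K) * Θ ω = z)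
    (hhyper : ∃ x : K, x ≠ 0 ∧ h * Θ x * x + ρ (h * Θ x * x) = 0)
    {lam u : K} (hlam : lam * Θ lam = 1) (hu : ρ u = u) (hu1 : u * Θ u = 1)
    {m jl : ℕ} (hm : Valued.v (lam - u) = exp (-(m : ℤ))) (hjl : Valued.v ((lam - u) - ρ (lam - u)) = exp (-(jl : ℤ)))
    {j a : ℕ} (_hj : j ≤ jl) (_ha : 1 ≤ a) (hdiag : j + m = jl + a) (htop : m + 1 ≤ 2 * a) :
    (∃ N : K, Θ N = N ∧ Valued.v N = 1 ∧ Valued.v (ρ h / h * (ρ N / N) + ρ (lam - u) / (lam - u)) ≤ exp (-((j + a : ℕ) - (m : ℤ)))) ↔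
      ((∃ k : ℕ, d + m + 2 * k = jl) ∧ 2 * j + d ≤ 2 * jl + 1) := by
  obtain ⟨hκ1, hκ, hκm, hκΘ, hmjl⟩ := token_kappa hρρ hvρ hΘρ hvΘ hlam hu hu1 hm hjl
  set κ : K := ρ (lam - u) / (lam - u) with hκdef
  have hρh0 : ρ h ≠ 0 := (map_ne_zero ρ).2 hh
  have hs : (-((j + a : ℕ) - (m : ℤ))) = -((j + a - m : ℕ) : ℤ) := by push_cast; omega
  -- the unit translator of the hyperbolic side: `η·t(ω₀) = −1`, `N₀ = ω₀Θω₀`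
  obtain ⟨ω₀, hω₀, hη⟩ := exists_unit_twist_eq_of_isotropic hΘρ hϖE hρϖE hh hhyper
  have hN00 : (ω₀ : K) * Θ ω₀ ≠ 0 := mul_ne_zero ω₀.ne_zero ((map_ne_zero Θ).2 ω₀.ne_zero)
  have hN0Θ : Θ ((ω₀ : K) * Θ ω₀) = (ω₀ : K) * Θ ω₀ := by rw [map_mul, hΘΘ, mul_comm]
  have hvN0 : Valued.v ((ω₀ : K) * Θ ω₀) = 1 := by rw [map_mul, hvΘ, hω₀, mul_one]
  constructor
  · rintro ⟨N, hΘN, hN1, hbit⟩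
    have hN0 : N ≠ 0 := fun h0 => by rw [h0, map_zero] at hN1; exact zero_ne_one hN1
    -- `x := −η·ρN∕N = ρN₂∕N₂` with `N₂ = N ∕ N₀`
    obtain ⟨n₂, hn₂⟩ := hjfix (N / ((ω₀ : K) * Θ ω₀)) (by rw [map_div₀, hΘN, hN0Θ])
    have hvn₂ : Valued.v n₂ = 1 := by rw [← hjv, hn₂, map_div₀, hN1, hvN0, div_one]
    have hn₂0 : n₂ ≠ 0 := fun h0 => by rw [h0, map_zero] at hvn₂; exact zero_ne_one hvn₂
    have hxeq : -(ρ h / h * (ρ N / N)) = jK (σ' n₂) / jK n₂ := by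
      rw [hjσ, hn₂, map_div₀]
      have hη' : ρ h / h = -(((ω₀ : K) * Θ ω₀) / ρ ((ω₀ : K) * Θ ω₀)) := by
        have hρN00 : ρ ((ω₀ : K) * Θ ω₀) ≠ 0 := (map_ne_zero ρ).2 hN00
        calc ρ h / h = ρ h / h * (ρ ((ω₀ : K) * Θ ω₀) / ((ω₀ : K) * Θ ω₀)) * (((ω₀ : K) * Θ ω₀) / ρ ((ω₀ : K) * Θ ω₀)) := by
              rw [mul_assoc, div_mul_div_comm, mul_comm (ρ ((ω₀ : K) * Θ ω₀)) ((ω₀ : K) * Θ ω₀), div_self (mul_ne_zero hN00 hρN00), mul_one]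
          _ = -(((ω₀ : K) * Θ ω₀) / ρ ((ω₀ : K) * Θ ω₀)) := by rw [hη, neg_one_mul]
      rw [hη']
      field_simp
    set x : K := jK (σ' n₂) / jK n₂ with hxdef
    have hΘx : Θ x = x := by rw [hxdef, map_div₀, hjΘ, hjΘ]
    have hx : x * ρ x = 1 := by
      rw [hxdef, map_div₀, ← hjσ, ← hjσ, hσ', div_mul_div_comm, mul_comm (jK (σ' n₂)) (jK n₂), div_self]
      exact mul_ne_zero ((map_ne_zero jK).2 hn₂0) ((map_ne_zero jK).2 ((map_ne_zero σ').2 hn₂0))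
    have hκx : Valued.v (κ - x) ≤ exp (-((j + a - m : ℕ) : ℤ)) := by
      rw [← hxeq, sub_neg_eq_add, add_comm, ← hs]; exact hbit
    -- the depth of `x` is `ℓ = jλ − m`, and lies in `d + 2ℕ`
    have hs0 : jl - m < j + a - m := by omega
    have hx1 : Valued.v (x - 1) = exp (-((jl : ℤ) - m)) := by
      have hlt : Valued.v (κ - x) < Valued.v (κ - 1) := by
        rw [hκm]; exact hκx.trans_lt (by rw [exp_lt_exp]; omega)
      have := Valuation.map_sub_eq_of_lt_left Valued.v (x := κ - 1) (y := κ - x) hlt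
      rw [sub_sub_sub_cancel_left] at this
      rw [this, hκm]
    have hx1' : Valued.v (x - 1) = Valued.v (σ' n₂ - n₂) := by
      rw [hxdef, div_sub_one ((map_ne_zero jK).2 hn₂0), map_div₀, hjv, hvn₂, div_one, ← map_sub, hjv]
    have hskew : σ' (σ' n₂ - n₂) = -(σ' n₂ - n₂) := by rw [map_sub, hσ']; ring
    have hsk0 : σ' n₂ - n₂ ≠ 0 := by
      intro h0
      rw [hx1', h0, map_zero] at hx1
      exact exp_ne_zero hx1.symm
    obtain ⟨k₀, hk₀⟩ := exists_v_eq_exp_of_map_eq_neg hσ' hfix' hπ' hdd' hskew hsk0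
    have hdeep : Valued.v (σ' n₂ - n₂) ≤ exp (-(d : ℤ)) := by
      rw [← neg_sub, Valuation.map_neg]
      refine (v_sub_map_le_of_v_le_one hσ' hfix' hπ' hdd' hvn₂.le).trans_eq ?_
      rw [hπ', ← exp_nsmul, nsmul_eq_mul, mul_neg, mul_one]
    rw [hx1'] at hx1
    have hpar : 2 * k₀ - (d : ℤ) = -((jl : ℤ) - m) := by rw [hk₀, exp_inj] at hx1; exact hx1
    have hge : (jl : ℤ) - m ≥ d := by rw [hx1, exp_le_exp] at hdeep; omega
    refine ⟨⟨(-k₀).toNat, by omega⟩, ?_⟩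
    -- the bound
    have hmin := min_le_of_thetaFixed_near hρρ hvρ hΘΘ hΘρ hvΘ hα1 hα hρϖE hϖE hσ' hfix' hπ' hdd' jK hjv hjfix hjσ hκ hΘx hx
      (s := j + a - m) (by omega) hκx hκΘ
    rcases min_le_iff.1 hmin with h1 | h1 <;> push_cast [show m ≤ j + a by omega] at h1 <;> omega
  · rintro ⟨⟨k, hk⟩, hbd⟩
    -- EXISTENCE: a Θ-fixed ρ-norm-one `x` within `exp(−(jλ − d + 1)) ≤ exp(−s₀)` of `κ`
    obtain ⟨x, hΘx, hx, hκx⟩ := exists_thetaFixed_normOne_near hρρ hvρ hΘΘ hΘρ hvΘ hϖE h2 hσ' hvσ' hfix' hπ' hdd' hd jK hjv hjΘ hjfix hjσ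
      hnorm hκ (jl := jl) hκΘ.le (by omega)
    have hκx' : Valued.v (κ - x) ≤ exp (-((j + a - m : ℕ) : ℤ)) := hκx.trans (by rw [exp_le_exp]; push_cast [show m ≤ j + a by omega]; omega)
    have hvx : Valued.v x = 1 := v_eq_one_of_v_mul_map_eq_one hvρ (by rw [hx]; exact Valuation.map_one _)
    have hx0 : x ≠ 0 := fun h0 => by rw [h0, map_zero] at hvx; exact zero_ne_one hvx
    -- the depth of `x` is `ℓ ≥ d`, so `x = a'∕σ'a'` with a unit `a'`
    have hx1 : Valued.v (x - 1) = exp (-((jl : ℤ) - m)) := by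
      have hlt : Valued.v (κ - x) < Valued.v (κ - 1) := by
        rw [hκm]; exact hκx'.trans_lt (by rw [exp_lt_exp]; omega)
      have := Valuation.map_sub_eq_of_lt_left Valued.v (x := κ - 1) (y := κ - x) hlt
      rw [sub_sub_sub_cancel_left] at this
      rw [this, hκm]
    obtain ⟨x', hx'⟩ := hjfix x hΘx
    have hx'0 : x' ≠ 0 := by rintro rfl; rw [map_zero] at hx'; exact hx0 hx'.symm
    have hx'n : x' * σ' x' = 1 := jK.injective (by rw [map_mul, hjσ, hx', hx, map_one])
    have hdepth : Valued.v (x' - 1) ≤ Valued.v π' ^ d := by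
      rw [← hjv, map_sub, map_one, hx', hx1, hπ', ← exp_nsmul, nsmul_eq_mul, exp_le_exp]; omega
    obtain ⟨a', ha'1, hxa'⟩ := exists_unit_eq_div_map hσ' hvσ' hfix' hπ' hdd' hd hx'n hdepth
    have ha'0 : a' ≠ 0 := fun h0 => by rw [h0, map_zero] at ha'1; exact zero_ne_one ha'1
    -- `N := N₀ · jK(σ'a')`
    refine ⟨(ω₀ : K) * Θ ω₀ * jK (σ' a'), by rw [map_mul, hN0Θ, hjΘ], by rw [map_mul, hvN0, hjv, hvσ', ha'1, mul_one], ?_⟩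
    have hquot : ρ h / h * (ρ ((ω₀ : K) * Θ ω₀ * jK (σ' a')) / ((ω₀ : K) * Θ ω₀ * jK (σ' a'))) = -x := by
      have hjσa : jK (σ' (σ' a')) = jK a' := by rw [hσ']
      rw [map_mul ρ, ← hjσ, hjσa, mul_div_mul_comm, ← mul_assoc, hη, ← map_div₀, ← hxa', hx', neg_one_mul]
    rw [hquot, hs, ← sub_eq_neg_add]; exact hκx'


/-- **(R1-TOP-SIDE, HYPERBOLIC) in ★ T5s letters**: the same law with the parity clause spelled decidably, `(d + m ≤ jλ ∧ (jλ − d − m) % 2 = 0) ∧ 2j + d ≤ 2jλ + 1` —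
token for token the test of ★ `toricCensusSum_unr_v5`'s `hvTopP`. [cite: Serre1979, Ch. V §3 Prop. 5, Cor. 3] [cite: Jacobowitz1962, §4] -/
theorem topBit_hyper_iff' [IsAdicComplete 𝓂[K'] 𝒪[K']]
    (hρρ : ∀ x, ρ (ρ x) = x) (hvρ : ∀ x, Valued.v (ρ x) = Valued.v x) (hΘΘ : ∀ x, Θ (Θ x) = x) (hΘρ : ∀ x, Θ (ρ x) = ρ (Θ x))
    (hvΘ : ∀ x, Valued.v (Θ x) = Valued.v x) (hα1 : Valued.v α ≤ 1) (hα : Valued.v (α - ρ α) = 1)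
    (hρϖE : ρ ϖE = ϖE) (hϖE : Valued.v ϖE = exp (-1 : ℤ)) (h2 : Valued.v (2 : K) = Valued.v ϖE ^ t) (hΘh : Θ h = h) (hh : h ≠ 0)
    (hσ' : ∀ x, σ' (σ' x) = x) (hvσ' : ∀ x, Valued.v (σ' x) = Valued.v x) (hfix' : ∀ x : K', σ' x = x → x ≠ 0 → ∃ n : ℤ, Valued.v x = exp (2 * n))
    (hπ' : Valued.v π' = exp (-1 : ℤ)) (hdd' : Valued.v (π' - σ' π') = Valued.v π' ^ d) (hd : 1 ≤ d)
    (jK : K' →+* K) (hjv : ∀ x, Valued.v (jK x) = Valued.v x) (hjΘ : ∀ x, Θ (jK x) = jK x)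
    (hjfix : ∀ z : K, Θ z = z → ∃ x, jK x = z) (hjσ : ∀ x, jK (σ' x) = ρ (jK x))
    (hnorm : ∀ z : Kˣ, Θ (z : K) = z → Valued.v (z : K) = 1 → ∃ ω : Kˣ, Valued.v (ω : K) = 1 ∧ (ω : K) * Θ ω = z)
    (hhyper : ∃ x : K, x ≠ 0 ∧ h * Θ x * x + ρ (h * Θ x * x) = 0)
    {lam u : K} (hlam : lam * Θ lam = 1) (hu : ρ u = u) (hu1 : u * Θ u = 1)
    {m jl : ℕ} (hm : Valued.v (lam - u) = exp (-(m : ℤ))) (hjl : Valued.v ((lam - u) - ρ (lam - u)) = exp (-(jl : ℤ)))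
    {j a : ℕ} (hj : j ≤ jl) (ha : 1 ≤ a) (hdiag : j + m = jl + a) (htop : m + 1 ≤ 2 * a) :
    (∃ N : K, Θ N = N ∧ Valued.v N = 1 ∧ Valued.v (ρ h / h * (ρ N / N) + ρ (lam - u) / (lam - u)) ≤ exp (-((j + a : ℕ) - (m : ℤ)))) ↔
      ((d + m ≤ jl ∧ (jl - d - m) % 2 = 0) ∧ 2 * j + d ≤ 2 * jl + 1) := by
  rw [topBit_hyper_iff hρρ hvρ hΘΘ hΘρ hvΘ hα1 hα hρϖE hϖE h2 hΘh hh hσ' hvσ' hfix' hπ' hdd' hd jK hjv hjΘ hjfix hjσ hnorm hhyper hlam hu hu1 hm hjl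
    hj ha hdiag htop]
  constructor
  · rintro ⟨⟨k, hk⟩, hbd⟩; exact ⟨⟨by omega, by omega⟩, hbd⟩
  · rintro ⟨⟨hle, hpar⟩, hbd⟩; exact ⟨⟨(jl - d - m) / 2, by omega⟩, hbd⟩

/-! ## §4 (R1-TOP-SIDE, ANISOTROPIC) -/

/-- **(R1-TOP-SIDE, ANISOTROPIC) — THE BIT LAW, sheet v5.**  Same cell, ANISOTROPIC scalar `h`: the (R1-TOP) bit equals `[jλ + 1 = d + m ∧ 2j + d ≤ 2jλ + 1]` — the coset
`−η·T♮⁰` sits at the single depth `d − 1` (★ `v_one_add_twist_eq_of_parity`), and `κ` is within `exp(−s)` of `T♮` iff `s ≤ jλ − d + 1`.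
[cite: Serre1979, Ch. V §3 Prop. 5, Cor. 3] [cite: Jacobowitz1962, §4] [cite: Flicker1998UnitaryFL, p. 84] -/
theorem topBit_aniso_iff [IsAdicComplete 𝓂[K'] 𝒪[K']]
    (hρρ : ∀ x, ρ (ρ x) = x) (hvρ : ∀ x, Valued.v (ρ x) = Valued.v x) (hΘΘ : ∀ x, Θ (Θ x) = x) (hΘρ : ∀ x, Θ (ρ x) = ρ (Θ x))
    (hvΘ : ∀ x, Valued.v (Θ x) = Valued.v x) (hα1 : Valued.v α ≤ 1) (hα : Valued.v (α - ρ α) = 1)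
    (hρϖE : ρ ϖE = ϖE) (hϖE : Valued.v ϖE = exp (-1 : ℤ)) (h2 : Valued.v (2 : K) = Valued.v ϖE ^ t) (hΘh : Θ h = h) (hh : h ≠ 0)
    (hσ' : ∀ x, σ' (σ' x) = x) (hvσ' : ∀ x, Valued.v (σ' x) = Valued.v x) (hfix' : ∀ x : K', σ' x = x → x ≠ 0 → ∃ n : ℤ, Valued.v x = exp (2 * n))
    (hπ' : Valued.v π' = exp (-1 : ℤ)) (hdd' : Valued.v (π' - σ' π') = Valued.v π' ^ d) (hd : 1 ≤ d)
    (jK : K' →+* K) (hjv : ∀ x, Valued.v (jK x) = Valued.v x) (hjΘ : ∀ x, Θ (jK x) = jK x)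
    (hjfix : ∀ z : K, Θ z = z → ∃ x, jK x = z) (hjσ : ∀ x, jK (σ' x) = ρ (jK x))
    (hnorm : ∀ z : Kˣ, Θ (z : K) = z → Valued.v (z : K) = 1 → ∃ ω : Kˣ, Valued.v (ω : K) = 1 ∧ (ω : K) * Θ ω = z)
    (haniso : ¬ ∃ x : K, x ≠ 0 ∧ h * Θ x * x + ρ (h * Θ x * x) = 0)
    {lam u : K} (hlam : lam * Θ lam = 1) (hu : ρ u = u) (hu1 : u * Θ u = 1)
    {m jl : ℕ} (hm : Valued.v (lam - u) = exp (-(m : ℤ))) (hjl : Valued.v ((lam - u) - ρ (lam - u)) = exp (-(jl : ℤ)))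
    {j a : ℕ} (_hj : j ≤ jl) (_ha : 1 ≤ a) (hdiag : j + m = jl + a) (htop : m + 1 ≤ 2 * a) :
    (∃ N : K, Θ N = N ∧ Valued.v N = 1 ∧ Valued.v (ρ h / h * (ρ N / N) + ρ (lam - u) / (lam - u)) ≤ exp (-((j + a : ℕ) - (m : ℤ)))) ↔
      (jl + 1 = d + m ∧ 2 * j + d ≤ 2 * jl + 1) := by
  obtain ⟨hκ1, hκ, hκm, hκΘ, hmjl⟩ := token_kappa hρρ hvρ hΘρ hvΘ hlam hu hu1 hm hjl
  set κ : K := ρ (lam - u) / (lam - u) with hκdef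
  have hρh0 : ρ h ≠ 0 := (map_ne_zero ρ).2 hh
  have hs : (-((j + a : ℕ) - (m : ℤ))) = -((j + a - m : ℕ) : ℤ) := by push_cast; omega
  -- parity of an anisotropic scalar and the constancy of the twist depth
  obtain ⟨n, hvh⟩ := exists_v_eq_exp_of_aniso hΘh hh hσ' hvσ' hπ' hdd' jK hjv hjΘ hjfix hjσ hnorm haniso
  have hconst := v_one_add_twist_eq_of_parity hΘΘ hvΘ hΘh hh hσ' hvσ' hfix' hπ' hdd' hd jK hjv hjfix hjσ hvh
  constructor
  · rintro ⟨N, hΘN, hN1, hbit⟩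
    have hN0 : N ≠ 0 := fun h0 => by rw [h0, map_zero] at hN1; exact zero_ne_one hN1
    obtain ⟨ω, hω, hωN⟩ := hnorm (Units.mk0 N hN0) (by rw [Units.val_mk0, hΘN]) (by rw [Units.val_mk0, hN1])
    rw [Units.val_mk0] at hωN
    set x : K := -(ρ h / h * (ρ N / N)) with hxdef
    have hΘx : Θ x = x := by rw [hxdef, map_neg, map_mul, map_div₀, map_div₀, hΘρ, hΘh, hΘρ, hΘN]
    have hx : x * ρ x = 1 := by
      have hρN0 : ρ N ≠ 0 := (map_ne_zero ρ).2 hN0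
      rw [hxdef, map_neg, map_mul, map_div₀, map_div₀, hρρ, hρρ, neg_mul_neg]
      field_simp
    have hκx : Valued.v (κ - x) ≤ exp (-((j + a - m : ℕ) : ℤ)) := by rw [hxdef, sub_neg_eq_add, add_comm, ← hs]; exact hbit
    -- the depth of `x` is `d − 1`, hence `ℓ = d − 1`
    have hx1 : Valued.v (x - 1) = exp (1 - (d : ℤ)) := by
      rw [hxdef, ← hωN, show -(ρ h / h * (ρ ((ω : K) * Θ ω) / ((ω : K) * Θ ω))) - 1 = -(1 + ρ h / h * (ρ ((ω : K) * Θ ω) / ((ω : K) * Θ ω))) by ring,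
        Valuation.map_neg, hconst ω hω]
    have hℓ : (jl : ℤ) - m = d - 1 := by
      have hlt : Valued.v (κ - x) < Valued.v (κ - 1) := by
        rw [hκm]; exact hκx.trans_lt (by rw [exp_lt_exp]; omega)
      have := Valuation.map_sub_eq_of_lt_left Valued.v (x := κ - 1) (y := κ - x) hlt
      rw [sub_sub_sub_cancel_left, hx1, hκm, exp_inj] at this
      omega
    refine ⟨by omega, ?_⟩
    have hmin := min_le_of_thetaFixed_near hρρ hvρ hΘΘ hΘρ hvΘ hα1 hα hρϖE hϖE hσ' hfix' hπ' hdd' jK hjv hjfix hjσ hκ hΘx hx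
      (s := j + a - m) (by omega) hκx hκΘ
    rcases min_le_iff.1 hmin with h1 | h1 <;> push_cast [show m ≤ j + a by omega] at h1 <;> omega
  · rintro ⟨hℓ, hbd⟩
    obtain ⟨x, hΘx, hx, hκx⟩ := exists_thetaFixed_normOne_near hρρ hvρ hΘΘ hΘρ hvΘ hϖE h2 hσ' hvσ' hfix' hπ' hdd' hd jK hjv hjΘ hjfix hjσ
      hnorm hκ (jl := jl) hκΘ.le (by omega)
    have hκx' : Valued.v (κ - x) ≤ exp (-((j + a - m : ℕ) : ℤ)) := hκx.trans (by rw [exp_le_exp]; push_cast [show m ≤ j + a by omega]; omega)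
    have hvx : Valued.v x = 1 := v_eq_one_of_v_mul_map_eq_one hvρ (by rw [hx]; exact Valuation.map_one _)
    have hx0 : x ≠ 0 := fun h0 => by rw [h0, map_zero] at hvx; exact zero_ne_one hvx
    have hx1 : Valued.v (x - 1) = exp (1 - (d : ℤ)) := by
      have hlt : Valued.v (κ - x) < Valued.v (κ - 1) := by
        rw [hκm]; exact hκx'.trans_lt (by rw [exp_lt_exp]; omega)
      have := Valuation.map_sub_eq_of_lt_left Valued.v (x := κ - 1) (y := κ - x) hlt
      rw [sub_sub_sub_cancel_left] at this
      rw [this, hκm]; congr 1; omega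
    -- `x = jK x'`, `x' = a₁∕σ'a₁` with `|a₁| = |π'|` (a unit representative would make `x` deeper than `d − 1`)
    obtain ⟨x', hx'⟩ := hjfix x hΘx
    have hx'0 : x' ≠ 0 := by rintro rfl; rw [map_zero] at hx'; exact hx0 hx'.symm
    have hx'n : x' * σ' x' = 1 := jK.injective (by rw [map_mul, hjσ, hx', hx, map_one])
    obtain ⟨a₁, hxa₁, ha₁⟩ := exists_rep_of_mul_map_eq_one hσ' hvσ' hπ' hdd' hx'n
    have ha₁π : Valued.v a₁ = Valued.v π' := by
      rcases ha₁ with ha₁ | ha₁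
      · exfalso
        have hle := v_div_map_sub_one_le_of_v_eq_one hσ' hvσ' hfix' hπ' hdd' ha₁
        rw [← hxa₁, ← hjv, map_sub, map_one, hx', hx1, hπ', ← exp_nsmul, nsmul_eq_mul, exp_le_exp] at hle
        omega
      · exact ha₁
    have ha₁0 : a₁ ≠ 0 := by rw [← (Valuation.ne_zero_iff Valued.v), ha₁π]; exact (Valuation.ne_zero_iff _).2 (v_varpi_zpow hπ' 0).1
    -- `h = jK h'`, the skew `e = π' − σ'π'`, and the unit `N' := σ'(e·a₁·h')·(π'σ'π')^(n − d)`
    obtain ⟨h', hh'⟩ := hjfix h hΘh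
    have hh'0 : h' ≠ 0 := by rintro rfl; rw [map_zero] at hh'; exact hh hh'.symm
    have hvh' : Valued.v h' = exp (2 * n + 1 - d) := by rw [← hjv, hh', hvh]
    have hπ0 : π' ≠ 0 := (v_varpi_zpow hπ' 0).1
    have he0 : π' - σ' π' ≠ 0 := sub_map_ne_zero hπ' hdd'
    have hσe : σ' (π' - σ' π') = -(π' - σ' π') := by rw [map_sub, hσ']; ring
    have hP0 : π' * σ' π' ≠ 0 := mul_ne_zero hπ0 ((map_ne_zero σ').2 hπ0)
    have hσP : σ' ((π' * σ' π') ^ ((n : ℤ) - d)) = (π' * σ' π') ^ ((n : ℤ) - d) := by rw [map_zpow₀, map_mul_map hσ']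
    set g : K' := (π' - σ' π') * a₁ * h' with hgdef
    have hg0 : g ≠ 0 := mul_ne_zero (mul_ne_zero he0 ha₁0) hh'0
    have hvg : Valued.v (σ' g) = exp (2 * n - 2 * (d : ℤ)) := by
      rw [hvσ', hgdef, map_mul, map_mul, hdd', ha₁π, hvh', hπ', ← exp_nsmul, nsmul_eq_mul, ← exp_add, ← exp_add]; congr 1; ring
    set N' : K' := σ' g * (π' * σ' π') ^ ((n : ℤ) - d) with hN'def
    have hvN' : Valued.v N' = 1 := by
      rw [hN'def, map_mul, hvg, map_zpow₀, map_mul, hvσ', hπ', ← exp_add, ← exp_zsmul, smul_eq_mul, ← exp_add, ← exp_zero]; congr 1; ring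
    have hquot' : σ' N' / N' = g / σ' g := by
      rw [hN'def, map_mul, hσ', hσP, mul_div_mul_right _ _ (zpow_ne_zero _ hP0)]
    -- `−x'∕η' = g∕σ'g`
    have hgx : g / σ' g = -(x' * (h' / σ' h')) := by
      rw [hgdef, map_mul, map_mul, hσe, hxa₁]
      have hσa₁0 : σ' a₁ ≠ 0 := (map_ne_zero σ').2 ha₁0
      have hσh'0 : σ' h' ≠ 0 := (map_ne_zero σ').2 hh'0
      field_simp
    refine ⟨jK N', hjΘ N', by rw [hjv, hvN'], ?_⟩
    have hquot : ρ h / h * (ρ (jK N') / jK N') = -x := by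
      rw [← hjσ, ← map_div₀, hquot', hgx, map_neg, map_mul, map_div₀, hjσ, hh', hx']
      field_simp
    rw [hquot, hs, ← sub_eq_neg_add]; exact hκx'

end Summit.HodgeConjecture.HodgeConjecture.Cruxes.H413.F0P3cDyRamToricLevelCensusUnr
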